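import Mathlib
import HarnessLib.Audit
import Summits.PneNP.PneNP.Theorems.PstarGateDirection

/-!
# One GATED chord, the two regimes in the model: PARALLEL (the gate reads like everyone else) and TRANSVERSE (ROUND-25, O2 / E2; prover-1 g18)

FRONTIER range-avoidance ladder, rung F-N3 (`stmt-PneNP-19007`), cell `pnp-ideate` (planner memo `r24/CORE-BOUND-NOTES.md` §14.34–14.35; nodes
`PstarCoupled.TerminalFiveCotree1Blind` / `PstarCoupledG.CoupledFourG`); restricted-model proof complexity — nothing here bears on `P` versus `NP`.

Continuation of `PstarGateDirection` (abstract `ChordSystem`).  The E2 configuration — every chord with constant reads except ONE chord `e` whose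
first private is read by the first constraint with a base-dependent coefficient `ℓ(a)` and whose second private is unread — splits by
`PstarGateDirection.direction_of_others` into two regimes (after the basis change that fixes the gate's direction `(1,0)`):

* CASE P (parallel): every read vector, the gate's included, has second coordinate `0` — the system is SINGLE-READ pointwise, the second
  constraint is state-free, `Z = {F₂ = t₂}`.  Then at every point of `Z` the first coordinate is unreachable (`unreach_fst_of_singleRead`), so
  (`PstarChordSystem.forced_of_read`, pointwise) every chord read at a point of `Z` is ON there — the constant-read chords on all of `Z`, the gated
  chord on `Z ∩ {ℓ = 1}` — and the first coordinate of "state-free part + forced reads" is the constant `t₁ + 1` on `Z` (`fst_eq_of_unreach_fst`):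
  the identity "`R + ℓ ≡ ¬t₁` on `Z`" of the memo;
* CASE T (transverse): the other chords read only the SECOND coordinate, the gate only the FIRST.  Then the first coordinate depends on the gate's
  state alone, so wherever it is reachable (`ReachFst`: `{ℓ = 0, F₁ = t₁} ∪ {ℓ = 1, u_e = 1, F₁ + 1 = t₁} ∪ {ℓ = 1, u_e = 0}` —
  `reachFst_iff`) the second coordinate is UNREACHABLE (`unreach_snd_of_reachFst`), hence every other (read) chord is ON there
  (`PstarGateDirection.forced_of_reach_fst`) and `F₂ +` forced reads `= t₂ + 1` there (`PstarGateDirection.snd_eq_of_unreach_snd`): the ENLARGED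
  forcing set `Z(R + ℓ + t₁) ∪ ({ℓ = 1} ∩ Z(u_e))` of the memo's CASE T.

Also the mirror images `unread_of_unreach_fst` / `fst_eq_of_unreach_fst` of the `h = 1` sumset lemmas of `PstarGateDirection`.  Pure model layer.
-/

set_option linter.dupNamespace false -- `Summit.PneNP.PneNP.…`: summit = sub-problem name (D-0017 single-conjunct layout)

open Finset
open Summit.PneNP.PneNP.Theorems.PstarReadSumset (V2)
open Summit.PneNP.PneNP.Theorems.PstarChordSystem (ChordSystem)
open Summit.PneNP.PneNP.Theorems.PstarGateDirection (forced_of_reach_fst unread_of_unreach_snd snd_eq_of_unreach_snd)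

namespace Summit.PneNP.PneNP.Theorems.PstarGateRegime

variable {ι A : Type*} [DecidableEq ι] (S : ChordSystem ι A)

/-- Every element of `𝔽₂` is `0` or `1`. -/
private theorem zmod2_cases (t : ZMod 2) : t = 0 ∨ t = 1 := by
  revert t; decide

/-! ## The `h = 1` sumset in the first coordinate (mirror images) -/

/-- **Unreachable first coordinate ⟹ killable chords are unread there (first coordinate).** -/
theorem unread_of_unreach_fst {E : Finset ι} {a : A} (hno : ∀ s, S.Adm E a s → (S.val E a s).1 ≠ S.t.1) {e : ι} (he : e ∈ E)
    (hu : S.u e a = 0) : (S.ρ e a).1 = 0 ∧ (S.ρ' e a).1 = 0 := by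
  let s₀ : ι → ZMod 2 × ZMod 2 := fun e' => (S.u e' a, 1)
  have hadm₀ : S.Adm E a s₀ := fun e' _ => by simp [s₀]
  set c := S.val (E.erase e) a s₀ with hc
  have hval : ∀ x : ZMod 2 × ZMod 2, x.1 * x.2 = 0 →
      (S.val E a (Function.update s₀ e x)).1 = x.1 * (S.ρ e a).1 + x.2 * (S.ρ' e a).1 + c.1 := by
    intro x hx
    rw [S.val_eq he, S.val_erase_update, S.contrib_update_self, ← hc, Prod.fst_add, Prod.fst_add, Prod.smul_fst, Prod.smul_fst,
      smul_eq_mul, smul_eq_mul]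
  have hne : ∀ x : ZMod 2 × ZMod 2, x.1 * x.2 = 0 → x.1 * (S.ρ e a).1 + x.2 * (S.ρ' e a).1 + c.1 ≠ S.t.1 := by
    intro x hx h
    exact hno _ (S.adm_update (S.adm_erase hadm₀ e) (by rw [hx, hu])) (by rw [hval x hx]; exact h)
  have h00 := hne (0, 0) (by simp)
  have h10 := hne (1, 0) (by simp)
  have h01 := hne (0, 1) (by simp)
  simp only [zero_mul, one_mul, add_zero, zero_add] at h00 h10 h01
  have key : ∀ r r' c t : ZMod 2, c ≠ t → r + c ≠ t → r' + c ≠ t → r = 0 ∧ r' = 0 := by decide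
  exact key _ _ _ _ h00 h10 h01

/-- **Unreachable first coordinate ⟹ `(F a).1 + Σ_{u_e(a) ≠ 0} (ρ_e + ρ'_e).1 = t.1 + 1`.** -/
theorem fst_eq_of_unreach_fst {E : Finset ι} {a : A} (hno : ∀ s, S.Adm E a s → (S.val E a s).1 ≠ S.t.1) :
    (S.F a).1 + ∑ e ∈ E.filter (fun e => ¬ S.u e a = 0), (S.ρ e a + S.ρ' e a).1 = S.t.1 + 1 := by
  let s₀ : ι → ZMod 2 × ZMod 2 := fun e' => (S.u e' a, 1)
  have hadm₀ : S.Adm E a s₀ := fun e' _ => by simp [s₀]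
  have h := hno s₀ hadm₀
  have hval : (S.val E a s₀).1 = (S.F a).1 + ∑ e ∈ E.filter (fun e => ¬ S.u e a = 0), (S.ρ e a + S.ρ' e a).1 := by
    unfold ChordSystem.val
    rw [Prod.fst_add, Prod.fst_sum, ← sum_filter_add_sum_filter_not E (fun e => S.u e a = 0)]
    have hk : ∑ e ∈ E.filter (fun e => S.u e a = 0), (S.contrib a s₀ e).1 = 0 := by
      refine sum_eq_zero fun e he => ?_
      obtain ⟨heE, hue⟩ := mem_filter.1 he
      have hr := unread_of_unreach_fst S hno heE hue
      unfold ChordSystem.contrib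
      rw [Prod.fst_add, Prod.smul_fst, Prod.smul_fst, hr.1, hr.2, smul_zero, smul_zero, add_zero]
    have hf : ∀ e ∈ E.filter (fun e => ¬ S.u e a = 0), (S.contrib a s₀ e).1 = (S.ρ e a + S.ρ' e a).1 := by
      intro e he
      obtain ⟨-, hue⟩ := mem_filter.1 he
      have h1 : S.u e a = 1 := (zmod2_cases _).resolve_left hue
      unfold ChordSystem.contrib
      simp only [s₀, h1, one_smul]
    rw [hk, zero_add, sum_congr rfl hf]
  rw [hval] at h
  have e2 : ∀ p q : ZMod 2, p ≠ q → p = q + 1 := by decide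
  exact e2 _ _ h

/-! ## CASE P: single-read at a point of `Z` -/

omit [DecidableEq ι] in
/-- **CASE P.**  If at `a` every read vector of every chord of `E` has second coordinate `0` (single-read AT `a`) and `(F a).2 = t.2`, then in an
infeasible system the first target coordinate is unreachable at `a`.  (The second coordinate is `t.2` in every state.)  Feed to
`unread_of_unreach_fst` (killable ⟹ unread: every chord read at `a`, the gated one included when `ℓ(a) = 1`, is ON) and `fst_eq_of_unreach_fst`
("`R + ℓ ≡ ¬t₁` on `Z`"). -/
theorem unreach_fst_of_singleRead_at {E : Finset ι} (hI : S.Infeasible E) {a : A} (hS : ∀ i ∈ E, (S.ρ i a).2 = 0 ∧ (S.ρ' i a).2 = 0)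
    (hZ : (S.F a).2 = S.t.2) : ∀ s, S.Adm E a s → (S.val E a s).1 ≠ S.t.1 := by
  intro s hadm h1
  refine hI a s hadm (Prod.ext h1 ?_)
  unfold ChordSystem.val
  rw [Prod.snd_add, Prod.snd_sum]
  have h0 : ∑ i ∈ E, (S.contrib a s i).2 = 0 := sum_eq_zero fun i hi => by
    unfold ChordSystem.contrib
    rw [Prod.snd_add, Prod.smul_snd, Prod.smul_snd, (hS i hi).1, (hS i hi).2, smul_zero, smul_zero, add_zero]
  rw [h0, add_zero]; exact hZ

/-- **CASE P, forced form**: single-read at `a ∈ Z`, infeasible ⟹ every chord of `E` read at `a` is ON at `a`. -/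
theorem forced_of_singleRead_at {E : Finset ι} (hI : S.Infeasible E) {a : A} (hS : ∀ i ∈ E, (S.ρ i a).2 = 0 ∧ (S.ρ' i a).2 = 0)
    (hZ : (S.F a).2 = S.t.2) {e : ι} (he : e ∈ E) (hR : S.Read e a) : S.u e a = 1 := by
  rcases zmod2_cases (S.u e a) with hu | hu
  · exfalso
    have h := unread_of_unreach_fst S (unreach_fst_of_singleRead_at S hI hS hZ) he hu
    rcases hR with h' | h'
    · exact h' (Prod.ext h.1 (hS e he).1)
    · exact h' (Prod.ext h.2 (hS e he).2)
  · exact hu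

/-! ## CASE T: the gate reads the first coordinate, everyone else the second -/

/-- **Transverse gate data at `a`**: the chords of `E` other than `e` read only the second coordinate at `a`; the gated chord `e` reads only the
first coordinate, and only through its first private. -/
def TransverseAt (E : Finset ι) (e : ι) (a : A) : Prop :=
  (∀ i ∈ E, i ≠ e → (S.ρ i a).1 = 0 ∧ (S.ρ' i a).1 = 0) ∧ S.ρ' e a = 0 ∧ (S.ρ e a).2 = 0

/-- The first coordinate is REACHABLE at `a`: some admissible state hits `t.1`. -/
def ReachFst (E : Finset ι) (a : A) : Prop := ∃ s, S.Adm E a s ∧ (S.val E a s).1 = S.t.1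

/-- In the transverse regime the first coordinate of the value is `(F a).1 + s_e.1 · (ρ_e a).1` — it sees the gate's state only. -/
theorem val_fst_of_transverse {E : Finset ι} {e : ι} (he : e ∈ E) {a : A} (hT : TransverseAt S E e a) (s : ι → ZMod 2 × ZMod 2) :
    (S.val E a s).1 = (S.F a).1 + (s e).1 * (S.ρ e a).1 := by
  obtain ⟨hoth, hρ', -⟩ := hT
  rw [S.val_eq he]
  unfold ChordSystem.val ChordSystem.contrib
  rw [Prod.fst_add, Prod.fst_add, Prod.fst_add, Prod.fst_sum, Prod.smul_fst, Prod.smul_fst, hρ', Prod.fst_zero, smul_zero, add_zero,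
    smul_eq_mul]
  have h0 : ∑ i ∈ E.erase e, ((s i).1 • S.ρ i a + (s i).2 • S.ρ' i a).1 = 0 := sum_eq_zero fun i hi => by
    obtain ⟨hie, hiE⟩ := mem_erase.1 hi
    rw [Prod.fst_add, Prod.smul_fst, Prod.smul_fst, (hoth i hiE hie).1, (hoth i hiE hie).2, smul_zero, smul_zero, add_zero]
  rw [h0, add_zero, add_comm]

/-- **CASE T: reachable first coordinate ⟹ unreachable second coordinate.**  (Transplant the gate's state from a witness of reachability into any
state hitting the second coordinate.) -/
theorem unreach_snd_of_reachFst {E : Finset ι} (hI : S.Infeasible E) {e : ι} (he : e ∈ E) {a : A} (hT : TransverseAt S E e a)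
    (hreach : ReachFst S E a) : ∀ s, S.Adm E a s → (S.val E a s).2 ≠ S.t.2 := by
  intro s hadm h2
  obtain ⟨s', hadm', h1'⟩ := hreach
  -- `s` with the gate's state taken from `s'`
  refine hI a (Function.update s e (s' e)) (S.adm_update (S.adm_erase hadm e) (hadm' e he)) (Prod.ext ?_ ?_)
  · rw [val_fst_of_transverse S he hT, Function.update_self, ← val_fst_of_transverse S he hT s']
    exact h1'
  · -- second coordinate: the gate does not read it
    have key : ∀ s₁ : ι → ZMod 2 × ZMod 2, (S.val E a s₁).2 = (S.F a).2 + (S.val (E.erase e) a s₁).2 - (S.F a).2 := by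
      intro s₁
      rw [S.val_eq he, Prod.snd_add]
      unfold ChordSystem.contrib
      rw [Prod.snd_add, Prod.smul_snd, Prod.smul_snd, hT.2.1, hT.2.2, Prod.snd_zero, smul_zero, smul_zero, add_zero, zero_add]
      ring
    rw [key, S.val_erase_update, ← key]
    exact h2

/-- **CASE T: the reachability set in closed form.**  `ReachFst` at `a` iff (`u_e(a) = 0` and `(ρ_e a).1 = 1`: the coupling region, `x_p` free), or
the all-forced value `(F a).1 + u_e(a)·(ρ_e a).1` equals `t.1` (chamber `{ℓ = 0}`: `F₁ = t₁`; chamber `{ℓ = 1}` with `e` ON: `F₁ + 1 = t₁`). -/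
theorem reachFst_iff {E : Finset ι} {e : ι} (he : e ∈ E) {a : A} (hT : TransverseAt S E e a) :
    ReachFst S E a ↔ (S.u e a = 0 ∧ (S.ρ e a).1 = 1) ∨ (S.F a).1 + S.u e a * (S.ρ e a).1 = S.t.1 := by
  constructor
  · rintro ⟨s, hadm, h1⟩
    rw [val_fst_of_transverse S he hT] at h1
    have hse := hadm e he
    rcases zmod2_cases (S.u e a) with hu | hu
    · -- killable: either the read is on, or the value without it already hits
      rcases zmod2_cases ((s e).1) with h0 | h0
      · right; rw [hu, zero_mul, add_zero]; rw [h0, zero_mul, add_zero] at h1; exact h1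
      · rcases zmod2_cases ((S.ρ e a).1) with hr | hr
        · right; rw [hu, zero_mul, add_zero]; rw [hr, mul_zero, add_zero] at h1; exact h1
        · exact Or.inl ⟨hu, hr⟩
    · right
      have hs1 : (s e).1 = 1 := by
        rcases zmod2_cases ((s e).1) with h0 | h0
        · rw [h0, zero_mul] at hse; rw [← hse] at hu; exact absurd hu (by decide)
        · exact h0
      rw [hu, one_mul]; rw [hs1, one_mul] at h1; exact h1
  · rintro (⟨hu, hr⟩ | h)
    · -- choose `x_p := t.1 + (F a).1`, `x_p' := 0`
      let s : ι → ZMod 2 × ZMod 2 := fun i => if i = e then (S.t.1 + (S.F a).1, 0) else (S.u i a, 1)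
      refine ⟨s, fun i hi => ?_, ?_⟩
      · by_cases hie : i = e
        · subst hie; simp [s, hu]
        · simp [s, hie]
      · rw [val_fst_of_transverse S he hT]
        simp only [s, if_true, hr, mul_one]
        have e2 : ∀ f t : ZMod 2, f + (t + f) = t := by decide
        exact e2 _ _
    · let s : ι → ZMod 2 × ZMod 2 := fun i => (S.u i a, 1)
      refine ⟨s, fun i _ => by simp [s], ?_⟩
      rw [val_fst_of_transverse S he hT]
      exact h

/-- **CASE T, forced form**: at a point where the first coordinate is reachable, every chord of `E` other than `e` that is read there is ON. -/
theorem forced_of_reachFst {E : Finset ι} (hI : S.Infeasible E) {e : ι} {a : A} (hT : TransverseAt S E e a)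
    (hreach : ReachFst S E a) {i : ι} (hi : i ∈ E) (hie : i ≠ e) (hR : S.Read i a) : S.u i a = 1 :=
  forced_of_reach_fst S hI hi hreach (hT.1 i hi hie) hR

/-- **CASE T, the coupling region**: where the gate reads (`(ρ_e a).1 = 1`) and `e` is killable, every other read chord is ON and the second
coordinate is unreachable — the model form of "`{ℓ = 1} ∩ Z(u_e) ⊆ ⋂ Z(u_{e'} + 1) ∩ {F₂ = κ}`". -/
theorem forced_on_coupling_region {E : Finset ι} (hI : S.Infeasible E) {e : ι} (he : e ∈ E) {a : A} (hT : TransverseAt S E e a)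
    (hu : S.u e a = 0) (hr : (S.ρ e a).1 = 1) :
    (∀ i ∈ E, i ≠ e → S.Read i a → S.u i a = 1) ∧ (∀ s, S.Adm E a s → (S.val E a s).2 ≠ S.t.2) ∧
      (S.F a).2 + ∑ i ∈ E.filter (fun i => ¬ S.u i a = 0), (S.ρ i a + S.ρ' i a).2 = S.t.2 + 1 := by
  have hreach : ReachFst S E a := (reachFst_iff S he hT).2 (Or.inl ⟨hu, hr⟩)
  exact ⟨fun i hi hie hR => forced_of_reachFst S hI hT hreach hi hie hR, unreach_snd_of_reachFst S hI he hT hreach,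
    snd_eq_of_unreach_snd S (unreach_snd_of_reachFst S hI he hT hreach)⟩

/-- **CASE T, the two chambers of the clean member**: where `(F a).1 + u_e(a)·(ρ_e a).1 = t.1` (i.e. `F₁ = t₁` on `{ℓ = 0}`, `F₁ + 1 = t₁` on
`{ℓ = 1} ∩ {u_e = 1}`), the same conclusions hold — the model form of "`Z(R + ℓ + t₁) ⊆ ⋂ Z(u_{e'} + 1) ∩ {F₂ = κ}`". -/
theorem forced_on_clean_zero {E : Finset ι} (hI : S.Infeasible E) {e : ι} (he : e ∈ E) {a : A} (hT : TransverseAt S E e a)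
    (h : (S.F a).1 + S.u e a * (S.ρ e a).1 = S.t.1) :
    (∀ i ∈ E, i ≠ e → S.Read i a → S.u i a = 1) ∧ (∀ s, S.Adm E a s → (S.val E a s).2 ≠ S.t.2) ∧
      (S.F a).2 + ∑ i ∈ E.filter (fun i => ¬ S.u i a = 0), (S.ρ i a + S.ρ' i a).2 = S.t.2 + 1 := by
  have hreach : ReachFst S E a := (reachFst_iff S he hT).2 (Or.inr h)
  exact ⟨fun i hi hie hR => forced_of_reachFst S hI hT hreach hi hie hR, unreach_snd_of_reachFst S hI he hT hreach,
    snd_eq_of_unreach_snd S (unreach_snd_of_reachFst S hI he hT hreach)⟩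

end Summit.PneNP.PneNP.Theorems.PstarGateRegime
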